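import Summits.ValiantsHypothesis.ValiantsHypothesis.Theorems.KPlusLogSqLawTropicalBPark4bM13Defs

/-!
# Route «KPlusLogSqLaw», crux `TropicalB` (stmt-ValiantsHypothesis-19771) — kernel form of an exact LP certificate:
# the 29-term «rotation + swap ladder + anchored fast cycle» static K = 4 chain at m = 13 is NOT REALIZABLE

HONEST FRAMING.  Helper toward the registered stubs `stub_tropThin` / `stub_tropFat` of `Cruxes/TropicalB/Lines/birth.lean` (crux
`TropicalB`, item stmt-ValiantsHypothesis-19771; cell `pub-symmetroid`, seat val-sym-trop-p1 g7, 2026-08-27; `--supports … --as helper`).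
A LOCATED NEGATIVE about ONE candidate construction (seat memo SHADOW-AND-WALKS-g6 §4.2–4.7, certificate `py/park4b_m13_MINCERT.json`,
two-seat verified R1954): nothing here bounds `TropicalB`, and nothing bears on `TropicalB` in its window, `WeakLifting`, DoorA26/34,
`MatrixDescartes` (stmt-ValiantsHypothesis-18050) or VP ≠ VNP.

THE STATEMENT.  Static design on `Fin 13 × Fin 13` with classes `cls r i ∈ Fin 4` on the present cells (`pres`), exponents
`d = (0, 1, 14, 196)`; the 29 terms `chainTerm k = (σ_k, i ↦ cls (σ_k i) i)` of the 3-digit architecture (phases p ∈ {0,4,8},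
MID ladder q, anchored fast cycle r; labels (p,q,r) in the memo).  `not_realizable`: there are NO valuations `v` and integer slopes
`θ_k` making every `chainTerm k` the unique optimum at `θ_k` — although the sequence passes every PAIRWISE exchange law of the cell's
toolbox (memo §4.3; the pairwise part is not re-proved here).  PROOF: 31 dominance comparisons «`chainTerm k` beats the present
competitor `τ_j` at `θ_k`» (rows of the irreducible exact Farkas certificate, positive rational multipliers summing to 1, `Aᵀu = 0`)
are linear in the cell valuations and the `θ_k`; `linarith` recovers the certificate.  STRUCTURE of the certificate (located): it is BALANCED PER TERM — for each chain term the positive weights of its rows average the competitors' slopes to the term's own slope (`Σ_{j : k_j = k} u_j (S_k − S(τ_j)) = 0` for every `k`) and the weighted competitor cells recombine the weighted chain cells — so it is an instance, with unequal rational multiplicities, of the many-body exchange law `TropicalExchange.sum_mul_slope_lt_of_redecomp` in which the slope side vanishes identically: the contradiction `0 < 0` uses neither the order nor the distinctness of the `θ_k` (26 «ladder» rows between chain neighbours + 5 cross-phase HYBRID competitors, memo §4.7).  This file: the theorem; the data (`dd`, `cls`, `pres`, the permutations, `chainTerm`) are in the sibling Defs module.  Generated by `cert2lean.py` (seat fo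lder
work/cert/, deposited in HOME/val-sym-trop-p1/g7/) from `park4b_m13.json` + `park4b_m13_MINCERT.json`; the generator is the reusable part.
[located finite certificate; folklore LP duality]
-/

set_option linter.dupNamespace false
set_option autoImplicit false

namespace Summit.ValiantsHypothesis.ValiantsHypothesis.Theorems.KPlusLogSqLaw

open Summit.ValiantsHypothesis.ValiantsHypothesis.Theorems.MatrixDescartes.Negative
open scoped BigOperators

namespace Park4bM13

/-- a term read off `cls` on present cells is present for every sign pattern supported on the static cells. -/
theorem termSign_ne_zero_of_pres (ε : Fin 13 → Fin 13 → Fin 4 → ℤ) (hε : ∀ r i : Fin 13, pres r i = true → ε r i (cls r i) ≠ 0)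
    (σ : Equiv.Perm (Fin 13)) (h : ∀ i, pres (σ i) i = true) : termSign ε (termOf σ) ≠ 0 :=
  (termSign_ne_zero_iff ε _).2 fun i => hε _ _ (h i)

/-- **NOT REALIZABLE.**  For every sign pattern `ε` present on the static cells (`ε r i (cls r i) ≠ 0` wherever
`pres r i`), no valuation `v` and integer slopes `θ_k` make all 29 terms `chainTerm k` unique optima of the design `(dd, v, ε)`: the 31 dominance rows of the exact Farkas certificate sum (with positive weights) to `0 < 0`. [located certificate] -/
theorem not_realizable (ε : Fin 13 → Fin 13 → Fin 4 → ℤ) (hε : ∀ r i : Fin 13, pres r i = true → ε r i (cls r i) ≠ 0) :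
    ¬ ∃ (v : Fin 13 → Fin 13 → Fin 4 → ℤ) (θ : Fin 29 → ℤ), ∀ k, IsDominant dd v ε (θ k) (chainTerm k) := by
  rintro ⟨v, θ, h⟩
  have r0 := (h 3).2 (termOf τ17)
    (fun e => absurd (congrArg (fun q : Equiv.Perm (Fin 13) × (Fin 13 → Fin 4) => q.1 0) e) (by decide))
    (termSign_ne_zero_of_pres ε hε τ17 (by decide))
  have r1 := (h 3).2 (termOf τ0)
    (fun e => absurd (congrArg (fun q : Equiv.Perm (Fin 13) × (Fin 13 → Fin 4) => q.1 0) e) (by decide))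
    (termSign_ne_zero_of_pres ε hε τ0 (by decide))
  have r2 := (h 4).2 (termOf τ18)
    (fun e => absurd (congrArg (fun q : Equiv.Perm (Fin 13) × (Fin 13 → Fin 4) => q.1 0) e) (by decide))
    (termSign_ne_zero_of_pres ε hε τ18 (by decide))
  have r3 := (h 4).2 (termOf τ12)
    (fun e => absurd (congrArg (fun q : Equiv.Perm (Fin 13) × (Fin 13 → Fin 4) => q.1 2) e) (by decide))
    (termSign_ne_zero_of_pres ε hε τ12 (by decide))
  have r4 := (h 5).2 (termOf τ0)
    (fun e => absurd (congrArg (fun q : Equiv.Perm (Fin 13) × (Fin 13 → Fin 4) => q.1 2) e) (by decide))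
    (termSign_ne_zero_of_pres ε hε τ0 (by decide))
  have r5 := (h 6).2 (termOf τ12)
    (fun e => absurd (congrArg (fun q : Equiv.Perm (Fin 13) × (Fin 13 → Fin 4) => q.1 2) e) (by decide))
    (termSign_ne_zero_of_pres ε hε τ12 (by decide))
  have r6 := (h 6).2 (termOf τ1)
    (fun e => absurd (congrArg (fun q : Equiv.Perm (Fin 13) × (Fin 13 → Fin 4) => q.1 2) e) (by decide))
    (termSign_ne_zero_of_pres ε hε τ1 (by decide))
  have r7 := (h 7).2 (termOf τ14)
    (fun e => absurd (congrArg (fun q : Equiv.Perm (Fin 13) × (Fin 13 → Fin 4) => q.1 2) e) (by decide))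
    (termSign_ne_zero_of_pres ε hε τ14 (by decide))
  have r8 := (h 7).2 (termOf τ10)
    (fun e => absurd (congrArg (fun q : Equiv.Perm (Fin 13) × (Fin 13 → Fin 4) => q.1 4) e) (by decide))
    (termSign_ne_zero_of_pres ε hε τ10 (by decide))
  have r9 := (h 8).2 (termOf τ1)
    (fun e => absurd (congrArg (fun q : Equiv.Perm (Fin 13) × (Fin 13 → Fin 4) => q.1 4) e) (by decide))
    (termSign_ne_zero_of_pres ε hε τ1 (by decide))
  have r10 := (h 8).2 (termOf τ11)
    (fun e => absurd (congrArg (fun q : Equiv.Perm (Fin 13) × (Fin 13 → Fin 4) => q.1 4) e) (by decide))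
    (termSign_ne_zero_of_pres ε hε τ11 (by decide))
  have r11 := (h 9).2 (termOf τ10)
    (fun e => absurd (congrArg (fun q : Equiv.Perm (Fin 13) × (Fin 13 → Fin 4) => q.1 4) e) (by decide))
    (termSign_ne_zero_of_pres ε hε τ10 (by decide))
  have r12 := (h 9).2 (termOf τ2)
    (fun e => absurd (congrArg (fun q : Equiv.Perm (Fin 13) × (Fin 13 → Fin 4) => q.1 4) e) (by decide))
    (termSign_ne_zero_of_pres ε hε τ2 (by decide))
  have r13 := (h 10).2 (termOf τ10)
    (fun e => absurd (congrArg (fun q : Equiv.Perm (Fin 13) × (Fin 13 → Fin 4) => q.1 4) e) (by decide))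
    (termSign_ne_zero_of_pres ε hε τ10 (by decide))
  have r14 := (h 10).2 (termOf τ8)
    (fun e => absurd (congrArg (fun q : Equiv.Perm (Fin 13) × (Fin 13 → Fin 4) => q.1 6) e) (by decide))
    (termSign_ne_zero_of_pres ε hε τ8 (by decide))
  have r15 := (h 11).2 (termOf τ2)
    (fun e => absurd (congrArg (fun q : Equiv.Perm (Fin 13) × (Fin 13 → Fin 4) => q.1 6) e) (by decide))
    (termSign_ne_zero_of_pres ε hε τ2 (by decide))
  have r16 := (h 11).2 (termOf τ4)
    (fun e => absurd (congrArg (fun q : Equiv.Perm (Fin 13) × (Fin 13 → Fin 4) => q.1 6) e) (by decide))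
    (termSign_ne_zero_of_pres ε hε τ4 (by decide))
  have r17 := (h 12).2 (termOf τ8)
    (fun e => absurd (congrArg (fun q : Equiv.Perm (Fin 13) × (Fin 13 → Fin 4) => q.1 6) e) (by decide))
    (termSign_ne_zero_of_pres ε hε τ8 (by decide))
  have r18 := (h 12).2 (termOf τ6)
    (fun e => absurd (congrArg (fun q : Equiv.Perm (Fin 13) × (Fin 13 → Fin 4) => q.1 8) e) (by decide))
    (termSign_ne_zero_of_pres ε hε τ6 (by decide))
  have r19 := (h 13).2 (termOf τ3)
    (fun e => absurd (congrArg (fun q : Equiv.Perm (Fin 13) × (Fin 13 → Fin 4) => q.1 8) e) (by decide))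
    (termSign_ne_zero_of_pres ε hε τ3 (by decide))
  have r20 := (h 13).2 (termOf τ4)
    (fun e => absurd (congrArg (fun q : Equiv.Perm (Fin 13) × (Fin 13 → Fin 4) => q.1 8) e) (by decide))
    (termSign_ne_zero_of_pres ε hε τ4 (by decide))
  have r21 := (h 14).2 (termOf τ6)
    (fun e => absurd (congrArg (fun q : Equiv.Perm (Fin 13) × (Fin 13 → Fin 4) => q.1 8) e) (by decide))
    (termSign_ne_zero_of_pres ε hε τ6 (by decide))
  have r22 := (h 14).2 (termOf τ5)
    (fun e => absurd (congrArg (fun q : Equiv.Perm (Fin 13) × (Fin 13 → Fin 4) => q.1 10) e) (by decide))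
    (termSign_ne_zero_of_pres ε hε τ5 (by decide))
  have r23 := (h 15).2 (termOf τ4)
    (fun e => absurd (congrArg (fun q : Equiv.Perm (Fin 13) × (Fin 13 → Fin 4) => q.1 10) e) (by decide))
    (termSign_ne_zero_of_pres ε hε τ4 (by decide))
  have r24 := (h 15).2 (termOf τ16)
    (fun e => absurd (congrArg (fun q : Equiv.Perm (Fin 13) × (Fin 13 → Fin 4) => q.1 0) e) (by decide))
    (termSign_ne_zero_of_pres ε hε τ16 (by decide))
  have r25 := (h 16).2 (termOf τ5)
    (fun e => absurd (congrArg (fun q : Equiv.Perm (Fin 13) × (Fin 13 → Fin 4) => q.1 0) e) (by decide))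
    (termSign_ne_zero_of_pres ε hε τ5 (by decide))
  have r26 := (h 2).2 (termOf τ15)
    (fun e => absurd (congrArg (fun q : Equiv.Perm (Fin 13) × (Fin 13 → Fin 4) => q.1 0) e) (by decide))
    (termSign_ne_zero_of_pres ε hε τ15 (by decide))
  have r27 := (h 12).2 (termOf τ7)
    (fun e => absurd (congrArg (fun q : Equiv.Perm (Fin 13) × (Fin 13 → Fin 4) => q.1 7) e) (by decide))
    (termSign_ne_zero_of_pres ε hε τ7 (by decide))
  have r28 := (h 10).2 (termOf τ9)
    (fun e => absurd (congrArg (fun q : Equiv.Perm (Fin 13) × (Fin 13 → Fin 4) => q.1 5) e) (by decide))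
    (termSign_ne_zero_of_pres ε hε τ9 (by decide))
  have r29 := (h 16).2 (termOf τ19)
    (fun e => absurd (congrArg (fun q : Equiv.Perm (Fin 13) × (Fin 13 → Fin 4) => q.1 0) e) (by decide))
    (termSign_ne_zero_of_pres ε hε τ19 (by decide))
  have r30 := (h 5).2 (termOf τ13)
    (fun e => absurd (congrArg (fun q : Equiv.Perm (Fin 13) × (Fin 13 → Fin 4) => q.1 2) e) (by decide))
    (termSign_ne_zero_of_pres ε hε τ13 (by decide))
  simp only [tropWeight, termOf, chainTerm, dd, cls, σ2, σ3, σ4, σ5, σ6, σ7, σ8, σ9, σ10, σ11, σ12, σ13, σ14, σ15, σ16, τ0, τ1, τ2, τ3, τ4, τ5, τ6, τ7, τ8, τ9, τ10, τ11, τ12, τ13, τ14, τ15, τ16, τ17, τ18, τ19, mkPerm, Equiv.coe_fn_mk, Fin.sum_univ_succ, Fin.sum_univ_zero, Matrix.cons_val, Matrix.cons_val_zero, Matrix.cons_val_succ, Fin.succ_zero_eq_one, Fin.succ_one_eq_two, Fin.isValue, Nat.cast_ofNat, Nat.cast_zero, Nat.cast_one, zero_add, add_zero, Fin.reduceSucc]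 at r0 r1 r2 r3 r4 r5 r6 r7 r8 r9 r10 r11 r12 r13 r14 r15 r16 r17 r18 r19 r20 r21 r22 r23 r24 r25 r26 r27 r28 r29 r30
  linarith

end Park4bM13

end Summit.ValiantsHypothesis.ValiantsHypothesis.Theorems.KPlusLogSqLaw
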